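import Summits.CriticalPhenomena.SAWScalingLimit.Theorems.LeftRightFKG.Negative.RectMesh
import Literature.Probability.Percolation.DualContours
import HarnessLib

/-!
# Crux `LeftRightFKG` (stmt-CriticalPhenomena-11232), line `corner-localisation` (v9):
combinatorics of self-avoiding walks in a 2-row ladder — the tails of a chord
(`stub_ladderStructureAux`, auxiliary to tool T4a `stub_ladderStructure`)

Let `G` be a graph on `Site 2` whose adjacency is lattice adjacency inside the open box
`(-1, L + 1) × (-1, 2)`, i.e. the lattice graph induced on the ladder `{0..L} × {0, 1}`. For a
self-avoiding walk `p : u ⇝ (L, 0)` of `G` from a ladder site `u` of column `i` that avoids the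
site West of `u` — every tail of a chord `(0, 0) ⇝ (L, 0)` is of this kind, the chord itself with
`i = 0` — we prove by induction on `n = L - i` (`stub_ladderStructureAux`): no dart of `p` crosses a
line `x = j + ½` with `j < i`; the signed crossing counts `wcross j 0 p` (`i ≤ j < L`) are `0` or
`1`; `|p| = n + #{j ∈ [i, L] : [1 ≤ wcross j 0 p] ≠ [1 ≤ prev j]}` with `prev i = u 1` and
`prev j = wcross (j - 1) 0 p` otherwise (one step East per column gap, one rung per change of row);
and `p` is determined by the counts `wcross j 0 p`, `i ≤ j < L`. The induction step is the COLUMN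
STEP `Ladder.column_step`: the first step of such a walk is East, or the rung at `u` followed by the
end of the walk or by a step East — after the rung, a step West would trap the walk in the columns
`< i` (discrete intermediate value property of the column coordinate, `exists_mem_support_col`),
both sites of column `i` being used up. Everything is elementary; no named facts are used. [folklore]
-/

open Literature.Probability.LatticeModels Literature.Probability.RandomPlanarGeometry
open Summit.CriticalPhenomena.SAWScalingLimit.Theorems.LeftRightFKG.Negative (bx pathCross wcross)
open Literature.Probability.Percolation.Contour (site_ext)

namespace Summit.CriticalPhenomena.SAWScalingLimit.Theorems.LeftRightFKG.Families

namespace Ladder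

section Ladder

variable {G : SimpleGraph (Site 2)} {L : ℕ}

/-- `wcross` of a walk with a first dart: the dart's crossing number plus the rest. [folklore] -/
theorem wcross_cons (m k : ℤ) {u v w : Site 2} (h : G.Adj u v) (p : G.Walk v w) :
    wcross m k (SimpleGraph.Walk.cons h p) = Negative.edgeCross m k u v + wcross m k p := by
  rw [Negative.wcross_eq_darts, Negative.wcross_eq_darts, SimpleGraph.Walk.darts_cons, List.map_cons,
    List.sum_cons]

/-- `wcross` of a trivial walk vanishes. [folklore] -/
theorem wcross_nil (m k : ℤ) (u : Site 2) : wcross m k (SimpleGraph.Walk.nil : G.Walk u u) = 0 :=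
  rfl

/-- Crossing numbers of a walk whose first step is East from `u`: the first dart crosses the line
`x = u 0 + ½`, and does so at level `0` iff `u` is on the top row. [folklore] -/
theorem wcross_east {u v z : Site 2} (h : G.Adj u v) (p : G.Walk v z)
    (hv : v 0 = u 0 + 1 ∧ v 1 = u 1) (hu1 : u 1 = 0 ∨ u 1 = 1) (m : ℤ) :
    wcross m 0 (SimpleGraph.Walk.cons h p) = (if m = u 0 ∧ u 1 = 1 then 1 else 0) + wcross m 0 p := by
  rw [wcross_cons]
  congr 1
  unfold Negative.edgeCross
  split_ifs <;> omega

/-- Crossing numbers of a walk whose first two steps are the rung at `u` and a step East. [folklore] -/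
theorem wcross_rung_east {u v w z : Site 2} (h : G.Adj u v) (h' : G.Adj v w) (p : G.Walk w z)
    (hv : v 0 = u 0 ∧ v 1 = 1 - u 1) (hw : w 0 = u 0 + 1 ∧ w 1 = 1 - u 1)
    (hu1 : u 1 = 0 ∨ u 1 = 1) (m : ℤ) :
    wcross m 0 (SimpleGraph.Walk.cons h (SimpleGraph.Walk.cons h' p)) =
      (if m = u 0 ∧ u 1 = 0 then 1 else 0) + wcross m 0 p := by
  rw [wcross_cons, wcross_cons, ← add_assoc]
  congr 1
  unfold Negative.edgeCross
  split_ifs <;> omega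

/-- Finset bookkeeping: peel the first column off `Ico i (n + 1)`. [folklore] -/
theorem card_filter_Ico {P Q : ℕ → Prop} [DecidablePred P] [DecidablePred Q] {i n : ℕ}
    (hi : i ≤ n) (hPQ : ∀ j, i + 1 ≤ j → j ≤ n → (P j ↔ Q j)) :
    ((Finset.Ico i (n + 1)).filter P).card =
      (if P i then 1 else 0) + ((Finset.Ico (i + 1) (n + 1)).filter Q).card := by
  rw [← Finset.insert_Ico_add_one_left_eq_Ico (Nat.lt_succ_of_le hi), Finset.filter_insert]
  have hQ : (Finset.Ico (i + 1) (n + 1)).filter P = (Finset.Ico (i + 1) (n + 1)).filter Q :=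
    Finset.filter_congr fun j hj => by
      rw [Finset.mem_Ico] at hj
      exact hPQ j hj.1 (by omega)
  have hni : i ∉ (Finset.Ico (i + 1) (n + 1)).filter Q := by simp
  split_ifs with hP
  · rw [hQ, Finset.card_insert_of_notMem hni, add_comm]
  · rw [hQ, zero_add]

/-- `bx a b` is the site with coordinates `a`, `b`. [folklore] -/
theorem bx_eq {a b : ℤ} {y : Site 2} (h0 : a = y 0) (h1 : b = y 1) : bx a b = y := by
  rw [Negative.eq_bx y, h0, h1]

/-- Discrete intermediate value property of the column coordinate along a lattice walk. [folklore] -/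
theorem exists_mem_support_col (hG : ∀ x y, G.Adj x y → (zdGraph 2).Adj x y) (m : ℤ) :
    ∀ {u v : Site 2} (p : G.Walk u v), u 0 ≤ m → m ≤ v 0 → ∃ x ∈ p.support, x 0 = m
  | u, _, SimpleGraph.Walk.nil, h1, h2 => ⟨u, by simp, le_antisymm h1 h2⟩
  | u, v, SimpleGraph.Walk.cons (v := u') h p, h1, h2 => by
    by_cases hu : u 0 = m
    · exact ⟨u, by simp, hu⟩
    · have hadj := Negative.adj_cases (hG _ _ h)
      obtain ⟨x, hx, hxm⟩ := exists_mem_support_col hG m p (by omega) h2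
      exact ⟨x, by simp [hx], hxm⟩

variable (hG : ∀ u v : Site 2, G.Adj u v ↔
  (zdGraph 2).Adj u v ∧ u ∈ Negative.Rect.box (-1) (L + 1) (-1) 2 ∧ v ∈ Negative.Rect.box (-1) (L + 1) (-1) 2)
include hG

/-- Under the ladder adjacency, the two ends of an edge are lattice neighbours and ladder sites.
[folklore] -/
theorem adj_ladder {u v : Site 2} (h : G.Adj u v) :
    ((v 0 = u 0 + 1 ∧ v 1 = u 1) ∨ (u 0 = v 0 + 1 ∧ v 1 = u 1) ∨
      (v 1 = u 1 + 1 ∧ v 0 = u 0) ∨ (u 1 = v 1 + 1 ∧ v 0 = u 0)) ∧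
    ((0 ≤ u 0 ∧ u 0 ≤ L) ∧ (0 ≤ u 1 ∧ u 1 ≤ 1)) ∧ ((0 ≤ v 0 ∧ v 0 ≤ L) ∧ (0 ≤ v 1 ∧ v 1 ≤ 1)) := by
  obtain ⟨ha, hu, hv⟩ := (hG u v).1 h
  simp only [Negative.Rect.box, Set.mem_setOf_eq] at hu hv
  exact ⟨Negative.adj_cases ha, by omega, by omega⟩

/-- Every vertex of a walk of the ladder graph from a ladder site is a ladder site. [folklore] -/
theorem support_ladder : ∀ {u v : Site 2} (p : G.Walk u v),
    (0 ≤ u 0 ∧ u 0 ≤ L) ∧ (0 ≤ u 1 ∧ u 1 ≤ 1) →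
    ∀ x ∈ p.support, (0 ≤ x 0 ∧ x 0 ≤ L) ∧ (0 ≤ x 1 ∧ x 1 ≤ 1)
  | _, _, SimpleGraph.Walk.nil, hu, x, hx => by
    rw [SimpleGraph.Walk.support_nil, List.mem_singleton] at hx; exact hx ▸ hu
  | _, _, SimpleGraph.Walk.cons h p, hu, x, hx => by
    rw [SimpleGraph.Walk.support_cons, List.mem_cons] at hx
    rcases hx with rfl | hx
    · exact hu
    · exact support_ladder p (adj_ladder hG h).2.2 x hx

/-- THE COLUMN STEP. Let `u → v ⇝ (L, 0)` be a self-avoiding walk of the ladder graph avoiding the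
site West of `u`. Then its first step is East; or it is the rung at `u` and the walk ends there
(`u = (L, 1)`); or it is the rung at `u` followed by a step East. (A first step West is excluded by
hypothesis; after the rung, stepping back is not self-avoiding, and a step West would trap the walk
in the columns `< u 0`: to reach column `L ≥ u 0` it must re-enter column `u 0` — discrete
intermediate value property — whose two sites are used up.) [folklore] -/
theorem column_step {u v : Site 2} (h : G.Adj u v) (p : G.Walk v (bx L 0))
    (hp : (SimpleGraph.Walk.cons h p).IsPath)
    (hW : bx (u 0 - 1) (u 1) ∉ (SimpleGraph.Walk.cons h p).support) :
    (v 0 = u 0 + 1 ∧ v 1 = u 1) ∨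
    (v 0 = u 0 ∧ v 1 = 1 - u 1 ∧ u 0 = L ∧ p.length = 0) ∨
    (v 0 = u 0 ∧ v 1 = 1 - u 1 ∧ ∃ (w : Site 2) (h' : G.Adj v w) (p' : G.Walk w (bx L 0)),
      w 0 = u 0 + 1 ∧ w 1 = 1 - u 1 ∧ p = SimpleGraph.Walk.cons h' p') := by
  rw [SimpleGraph.Walk.cons_isPath_iff] at hp
  obtain ⟨hp, hu⟩ := hp
  rw [SimpleGraph.Walk.support_cons, List.mem_cons, not_or] at hW
  obtain ⟨-, hW⟩ := hW
  obtain ⟨hadj, hub, hvb⟩ := adj_ladder hG h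
  have hv : (v 0 = u 0 + 1 ∧ v 1 = u 1) ∨ (v 0 = u 0 - 1 ∧ v 1 = u 1) ∨
      (v 0 = u 0 ∧ v 1 = 1 - u 1) := by omega
  rcases hv with hE | ⟨h0, h1⟩ | ⟨h0, h1⟩
  · exact Or.inl hE
  · -- a first step West is excluded
    refine absurd ?_ hW
    rw [show bx (u 0 - 1) (u 1) = v from bx_eq h0.symm h1.symm]
    exact p.start_mem_support
  · -- the rung at `u`
    cases p with
    | nil => exact Or.inr (Or.inl ⟨h0, h1, by simpa using h0.symm, rfl⟩)
    | cons h' p' =>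
      rename_i w
      rw [SimpleGraph.Walk.cons_isPath_iff] at hp
      obtain ⟨-, hvp'⟩ := hp
      rw [SimpleGraph.Walk.support_cons, List.mem_cons, not_or] at hu
      obtain ⟨-, hu⟩ := hu
      obtain ⟨hadj', -, hwb⟩ := adj_ladder hG h'
      have hw : (w 0 = u 0 + 1 ∧ w 1 = 1 - u 1) ∨ (w 0 = u 0 ∧ w 1 = u 1) ∨
          (w 0 = u 0 - 1 ∧ w 1 = 1 - u 1) := by omega
      rcases hw with ⟨hw0, hw1⟩ | ⟨hw0, hw1⟩ | ⟨hw0, hw1⟩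
      · exact Or.inr (Or.inr ⟨h0, h1, w, h', p', hw0, hw1, rfl⟩)
      · -- stepping back to `u`
        refine absurd ?_ hu
        rw [site_ext (a := u) (b := w) hw0.symm hw1.symm]
        exact p'.start_mem_support
      · -- a step West after the rung traps the walk
        exfalso
        obtain ⟨x, hx, hx0⟩ := exists_mem_support_col (fun x y hxy => ((hG x y).1 hxy).1) (u 0) p'
          (by omega) (by simp only [Negative.bx_zero]; omega)
        have hxb := support_ladder hG p' hwb x hx
        rcases (show x 1 = u 1 ∨ x 1 = v 1 by omega) with hx1 | hx1
        · exact hu (site_ext hx0 hx1 ▸ hx)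
        · exact hvp' (site_ext (hx0.trans h0.symm) hx1 ▸ hx)

end Ladder

end Ladder

/-- AUXILIARY REGISTERED THEOREM `stub_ladderStructureAux` (for tool T4a `stub_ladderStructure`):
THE STRUCTURE OF THE TAILS OF A LADDER CHORD, by induction on the number `n` of columns to go. Let
`G` have the ladder adjacency (lattice adjacency inside the open box `(-1, L+1) × (-1, 2)`). For a
self-avoiding walk `p : u ⇝ (L, 0)` of `G` from a ladder site `u` of column `i = L - n` avoiding the
site West of `u`: (Z) no crossing of the lines `x = j + ½`, `j < i`; (A) the crossing counts at the
faces `(j, 0)`, `i ≤ j < L`, are `0` or `1`; (C) `|p| + i = L + #{j ∈ [i, L] : [1 ≤ wcross j 0 p] ≠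
[1 ≤ prev j]}`, `prev i = u 1`, `prev j = wcross (j - 1) 0 p` (`j > i`); (D) `p` is determined by
its counts at the faces `(j, 0)`, `i ≤ j < L`. Induction step: `Ladder.column_step`. [folklore] -/
theorem stub_ladderStructureAux : ∀ (L : ℕ) (G : SimpleGraph (Site 2)),
    (∀ u v : Site 2, G.Adj u v ↔
      (zdGraph 2).Adj u v ∧ u ∈ Negative.Rect.box (-1) (L + 1) (-1) 2 ∧ v ∈ Negative.Rect.box (-1) (L + 1) (-1) 2) →
    ∀ (n i : ℕ) (u : Site 2) (p : G.Walk u (bx L 0)), i + n = L → u 0 = i → (u 1 = 0 ∨ u 1 = 1) →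
      p.IsPath → bx ((i : ℤ) - 1) (u 1) ∉ p.support →
      (∀ j : ℕ, j < i → wcross j 0 p = 0) ∧
      (∀ j : ℕ, i ≤ j → j < L → wcross j 0 p = 0 ∨ wcross j 0 p = 1) ∧
      p.length + i = L + ((Finset.Ico i (L + 1)).filter fun j : ℕ =>
        ¬ (1 ≤ wcross j 0 p ↔ 1 ≤ (if j = i then u 1 else wcross ((j : ℤ) - 1) 0 p))).card ∧
      ∀ q : G.Walk u (bx L 0), q.IsPath → bx ((i : ℤ) - 1) (u 1) ∉ q.support →
        (∀ j : ℕ, i ≤ j → j < L → wcross j 0 p = wcross j 0 q) → p = q := by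
  intro L G hG n
  induction n with
  | zero =>
    intro i u p hi hu0 hu1 hp hW
    obtain rfl : L = i := by omega
    cases p with
    | nil =>
      refine ⟨fun j _ => rfl, fun j hj hjL => by omega, ?_, fun q hq _ _ =>
        (SimpleGraph.Walk.eq_nil_iff_nil.2 (SimpleGraph.Walk.isPath_iff_nil.1 hq)).symm⟩
      rw [Nat.Ico_succ_singleton, Finset.filter_singleton, Ladder.wcross_nil]
      simp
    | cons h p' =>
      rename_i v
      rcases Ladder.column_step hG h p' hp (by rwa [hu0]) with
        ⟨hv0, hv1⟩ | ⟨hv0, hv1, -, hlen⟩ | ⟨hv0, hv1, w, h', p'', hw0, hw1, rfl⟩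
      · have := (Ladder.adj_ladder hG h).2.2; omega
      · cases p' with
        | cons _ _ => simp at hlen
        | nil =>
          simp only [Negative.bx_zero, Negative.bx_one] at hv0 hv1
          have hwc : ∀ m : ℤ,
              wcross m 0 (SimpleGraph.Walk.cons h SimpleGraph.Walk.nil : G.Walk u (bx L 0)) = 0 := by
            intro m
            rw [Ladder.wcross_cons, Ladder.wcross_nil, add_zero]
            unfold Negative.edgeCross
            simp only [Negative.bx_zero, Negative.bx_one]
            split_ifs <;> omega
          refine ⟨fun j _ => hwc j, fun j hj hjL => by omega, ?_, ?_⟩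
          · rw [Nat.Ico_succ_singleton, Finset.filter_singleton, hwc]
            simp only [SimpleGraph.Walk.length_cons, SimpleGraph.Walk.length_nil, if_true]
            rw [if_pos (by omega)]
            simp [add_comm]
          · intro q hq hWq _
            cases q with
            | nil => simp only [Negative.bx_one] at hv1; omega
            | cons g q' =>
              rcases Ladder.column_step hG g q' hq (by rwa [hu0]) with
                ⟨hx0, -⟩ | ⟨-, -, -, hlen'⟩ | ⟨-, -, w', g', q'', hw'0, -, rfl⟩
              · have := (Ladder.adj_ladder hG g).2.2; omega
              · cases q' with
                | cons _ _ => simp at hlen'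
                | nil => rfl
              · have := (Ladder.adj_ladder hG g').2.2; omega
      · have := (Ladder.adj_ladder hG h').2.2; omega
  | succ n ih =>
    intro i u p hi hu0 hu1 hp hW
    cases p with
    | nil => simp only [Negative.bx_zero] at hu0; omega
    | cons h p' =>
      rename_i v
      rcases Ladder.column_step hG h p' hp (by rwa [hu0]) with
        ⟨hv0, hv1⟩ | ⟨-, -, hL, -⟩ | ⟨hv0, hv1, w, h', p'', hw0, hw1, rfl⟩
      · -- first step East
        rw [SimpleGraph.Walk.cons_isPath_iff] at hp
        have hu : bx (((i + 1 : ℕ) : ℤ) - 1) (v 1) = u := Ladder.bx_eq (by push_cast; omega) hv1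
        obtain ⟨IZ, IA, IC, ID⟩ :=
          ih (i + 1) v p' (by omega) (by push_cast; omega) (by omega) hp.1 (by rw [hu]; exact hp.2)
        have hwc := Ladder.wcross_east h p' ⟨hv0, hv1⟩ hu1
        have hw0 : wcross (i : ℤ) 0 p' = 0 := IZ i i.lt_succ_self
        refine ⟨?_, ?_, ?_, ?_⟩
        · intro j hj
          rw [hwc, if_neg (by omega), zero_add]
          exact IZ j (by omega)
        · intro j hj hjL
          rw [hwc]
          rcases Nat.eq_or_lt_of_le hj with rfl | hlt
          · rw [hw0]; split_ifs <;> simp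
          · rw [if_neg (by omega), zero_add]
            exact IA j hlt hjL
        · rw [SimpleGraph.Walk.length_cons, Ladder.card_filter_Ico (by omega)
            (Q := fun j : ℕ => ¬ (1 ≤ wcross j 0 p' ↔
              1 ≤ (if j = i + 1 then v 1 else wcross ((j : ℤ) - 1) 0 p')))]
          · rw [if_neg, zero_add]
            · omega
            · rw [hwc, hw0, if_pos rfl, not_not]
              split_ifs <;> simp <;> omega
          · intro j hj1 hj2
            rw [if_neg (by omega), hwc, hwc, if_neg (by omega), zero_add]
            rcases Nat.eq_or_lt_of_le hj1 with rfl | hlt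
            · rw [if_pos rfl]
              push_cast
              rw [add_sub_cancel_right, hw0, add_zero]
              split_ifs <;> simp <;> omega
            · rw [if_neg (by omega), if_neg (by omega), zero_add]
        · intro q hq hWq hagree
          cases q with
          | nil => simp only [Negative.bx_zero] at hu0; omega
          | cons g q' =>
            rename_i v'
            rcases Ladder.column_step hG g q' hq (by rwa [hu0]) with
              ⟨hx0, hx1⟩ | ⟨-, -, hL, -⟩ | ⟨hx0, hx1, w', g', q'', hw'0, hw'1, rfl⟩
            · obtain rfl : v' = v := site_ext (by omega) (by omega)
              rw [SimpleGraph.Walk.cons_isPath_iff] at hq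
              have hwc' := Ladder.wcross_east g q' ⟨hv0, hv1⟩ hu1
              obtain rfl := ID q' hq.1 (by rw [hu]; exact hq.2) fun j hj hjL => by
                have := hagree j (by omega) hjL
                rwa [hwc, hwc', if_neg (by omega), zero_add, zero_add] at this
              rfl
            · omega
            · exfalso
              rw [SimpleGraph.Walk.cons_isPath_iff, SimpleGraph.Walk.cons_isPath_iff] at hq
              have hv'w : bx (((i + 1 : ℕ) : ℤ) - 1) (w' 1) = v' :=
                Ladder.bx_eq (by push_cast; omega) (by omega)
              obtain ⟨IZ', -, -, -⟩ := ih (i + 1) w' q'' (by omega) (by push_cast; omega) (by omega)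
                hq.1.1 (by rw [hv'w]; exact hq.1.2)
              have := hagree i le_rfl (by omega)
              rw [hwc, Ladder.wcross_rung_east g g' q'' ⟨hx0, hx1⟩ ⟨hw'0, hw'1⟩ hu1, hw0,
                IZ' i i.lt_succ_self] at this
              split_ifs at this <;> omega
      · -- rung and stop: impossible before the last column
        omega
      · -- rung, then East
        rw [SimpleGraph.Walk.cons_isPath_iff, SimpleGraph.Walk.cons_isPath_iff] at hp
        have hv : bx (((i + 1 : ℕ) : ℤ) - 1) (w 1) = v := Ladder.bx_eq (by push_cast; omega) (by omega)
        obtain ⟨IZ, IA, IC, ID⟩ :=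
          ih (i + 1) w p'' (by omega) (by push_cast; omega) (by omega) hp.1.1 (by rw [hv]; exact hp.1.2)
        have hwc := Ladder.wcross_rung_east h h' p'' ⟨hv0, hv1⟩ ⟨hw0, hw1⟩ hu1
        have hw0' : wcross (i : ℤ) 0 p'' = 0 := IZ i i.lt_succ_self
        refine ⟨?_, ?_, ?_, ?_⟩
        · intro j hj
          rw [hwc, if_neg (by omega), zero_add]
          exact IZ j (by omega)
        · intro j hj hjL
          rw [hwc]
          rcases Nat.eq_or_lt_of_le hj with rfl | hlt
          · rw [hw0']; split_ifs <;> simp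
          · rw [if_neg (by omega), zero_add]
            exact IA j hlt hjL
        · rw [SimpleGraph.Walk.length_cons, SimpleGraph.Walk.length_cons, Ladder.card_filter_Ico (by omega)
            (Q := fun j : ℕ => ¬ (1 ≤ wcross j 0 p'' ↔
              1 ≤ (if j = i + 1 then w 1 else wcross ((j : ℤ) - 1) 0 p'')))]
          · rw [if_pos]
            · omega
            · rw [hwc, hw0', if_pos rfl]
              split_ifs <;> simp <;> omega
          · intro j hj1 hj2
            rw [if_neg (by omega), hwc, hwc, if_neg (by omega), zero_add]
            rcases Nat.eq_or_lt_of_le hj1 with rfl | hlt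
            · rw [if_pos rfl]
              push_cast
              rw [add_sub_cancel_right, hw0', add_zero]
              split_ifs <;> simp <;> omega
            · rw [if_neg (by omega), if_neg (by omega), zero_add]
        · intro q hq hWq hagree
          cases q with
          | nil => simp only [Negative.bx_zero] at hu0; omega
          | cons g q' =>
            rename_i v'
            rcases Ladder.column_step hG g q' hq (by rwa [hu0]) with
              ⟨hx0, hx1⟩ | ⟨-, -, hL, -⟩ | ⟨hx0, hx1, w', g', q'', hw'0, hw'1, rfl⟩
            · exfalso
              rw [SimpleGraph.Walk.cons_isPath_iff] at hq
              have hv'u : bx (((i + 1 : ℕ) : ℤ) - 1) (v' 1) = u :=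
                Ladder.bx_eq (by push_cast; omega) (by omega)
              obtain ⟨IZ', -, -, -⟩ := ih (i + 1) v' q' (by omega) (by push_cast; omega) (by omega)
                hq.1 (by rw [hv'u]; exact hq.2)
              have := hagree i le_rfl (by omega)
              rw [hwc, Ladder.wcross_east g q' ⟨hx0, hx1⟩ hu1, hw0', IZ' i i.lt_succ_self] at this
              split_ifs at this <;> omega
            · omega
            · obtain rfl : v' = v := site_ext (by omega) (by omega)
              obtain rfl : w' = w := site_ext (by omega) (by omega)
              rw [SimpleGraph.Walk.cons_isPath_iff, SimpleGraph.Walk.cons_isPath_iff] at hq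
              have hwc' := Ladder.wcross_rung_east g g' q'' ⟨hv0, hv1⟩ ⟨hw0, hw1⟩ hu1
              obtain rfl := ID q'' hq.1.1 (by rw [hv]; exact hq.1.2) fun j hj hjL => by
                have := hagree j (by omega) hjL
                rwa [hwc, hwc', if_neg (by omega), zero_add, zero_add] at this
              rfl

end Summit.CriticalPhenomena.SAWScalingLimit.Theorems.LeftRightFKG.Families
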